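import Mathlib.Data.Int.Basic
import Mathlib.Data.List.Basic
import HarnessLib

/-!
# O5 (`9 ∥ N`): the BLOCK-LOCATION census at `9 ∥ N` — where the `3` of the congruence number sits among the
# five blocks `B0, B1, ω̃BT, ω̃St, SC`, as a function of (Kodaira type at `3`; one mod-`9` classifier) — SCHEMA
# (EVIDENCE records of o5-r2 GEN 8's zero-kit result BLOCKLOC; cell `b2b-bsdres`, lane CLASS-CLOSURE, team o5;
#  content = planner o5-r2 GEN 8, placement + schema + dedup = cc-typer-5) — DECIDABLE BOOKKEEPING, NOTHING ASSERTED

HONEST FRAMING (cell `b2b-bsdres`, run/shared/lean/b2b/bsd-rank1-residual/, verbatim in every file): the goal of the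
cell is to DELETE the COMBINATION-SHAPED residual classes of the Birch–Swinnerton-Dyer formula for ALL analytic-rank
`≤ 1` elliptic curves over `ℚ` — "full BSD formula for every rank `≤ 1` curve in class `C`" assembled STRICTLY from
published theorems — so that the rank-`≤ 1` remainder becomes exactly the CONSTRUCTION-SHAPED classes, which are TYPED
(missing-input `Prop`s), NOT attempted. This is not "finishing BSD". Lane CLASS-CLOSURE: research routes; census output
is EVIDENCE / conjecture items, never a Literature fact; nothing is booked and no mark of `RESIDUAL-MAP.md` moves.

## What is recorded (records ask R-BL, o5-r2 GEN 8, `HOME/INBOX.md` 2026-08-21T20:58Z; typed by cc-typer-5 GEN 10)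

SOURCE OF RECORD: `HOME/b2b-bsdres-o5-r2/gen8/blockloc/BLOCKLOC-RESULT.md` (sha16 `e71d445b00ed5623`), pre-registration
`BLOCKLOC-PREREG.md` (`eead2ab8cbfd2aac`, frozen BEFORE the row-level join was read), ZERO-KIT evaluator `blockloc_eval.py`
(`83acac9c47dd9041`), row table `blockloc_rows.tsv` (`7a48964623c46596`; 800/800 rows ok; Kodaira cross-check 0 mismatches).
POPULATION: the 800 optimal curves with `9 ∥ N ≤ 2000` of o5-r2 GEN 7's CONG3-F census (kit j136505–7, `N ≤ 1530`, 573 rows)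
and its E3 window (j136619–30, `1530 < N ≤ 2000`, 227 surjective non-CM rows), each with the EIGHT congruence numbers
`r(W;X)` of the newform `f_W` against the Hecke-stable blocks `X ∈ [B0, B1, ω̃BT, ω̃St, SC, B0⊕B1, B0⊕B1⊕ω̃BT⊕ω̃St, ALL]`
of the complement of `f_W` in `S₂(Γ₀(N))` (o5-r2 `gen7/BLOCKS-SCHEMA.md`: `B0`/`B1` = the two `3`-old blocks, `ω̃BT`/`ω̃St` =
their images under the twist involution `R_χ`, `χ = χ₋₃`, `SC` = the supercuspidal-at-`3` new block; `r(W;ALL) = r_E`).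
BITS: `BIT_X(W) := [ord₃ r(W;X) > 0]` for the five single blocks. CLASSIFIERS (from Cremona's minimal a-invariants):
III / III*: `Δ′ := Δ/3^{v₃Δ} mod 9`, `LocRed := [Δ′ ≢ ±1 (mod 9)]` (= `¬ LocIrr(3)`, x11b3-p7 p304384
`locIrr_three_iff_isPmOneModNine_of_subTprime`); I₀* with the `(−3)`-untwisted class ORDINARY: `j mod 9`, `Split := [j ≡ ±1 (mod 9)]`
(Serre–Tate: `E_G[3]|G_{ℚ₃}` split ⟺ `G ≡` canonical lift mod `9`); Iₙ* (`n = −v₃ j`): `u := (3ⁿ j)⁻¹ mod 9`, `Peu := [3 ∣ n]`,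
`Cube := [3 ∣ n ∧ u ≡ ±1 (mod 9)]` (`q_G ∈ (ℚ₃^×)³`). IMAGE: `surj` = Cremona `surj3 = 1` and `j` not CM; `cm` = CM
`j`-invariant (1089b1, 1521a1 — `j = 0`, type III, carried as `surj3 = 1` in the frozen scope column although `ρ̄₃` is
reducible; 1089e1 — `j = −32768`, I₀*-ord); `borel` = the remaining `surj3 = 0` rows (exploratory, no prediction).

THE LAW AS SCORED (o5-r2 GEN 8; on every `surj` row, X ≠ own block; 720 rows; ZERO exceptions — 214 positive + 830 negative
sharp bit-calls correct): **P1** Iₙ*: `BIT_ω̃BT = BIT_SC = Peu` (380/380, 68 positives); **P1′** Iₙ*: `BIT_B0 = BIT_B1 = Cube`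
(380/380; 7 positives 1062f1 1062h1 1395b1 1422g1 1656a1 1656h1 1827b1); **P2** I₀*-ord: `BIT_B0 = BIT_B1 = Split`,
`BIT_ω̃St = BIT_SC = 1` (84/84, 17 positives); **P3** I₀*-ss: `B0 = B1 = ω̃St = 0`, `SC = 1` (56/56; retrodiction); **P4** III*:
`B0 = 1`, `ω̃BT = ω̃St = 0` and III: `ω̃BT = 1`, `B0 = B1 = 0` (100/100 + 100/100; retrodictions); **P5** III*: `BIT_B1 = LocRed`
(100/100: 61 LocRed / 39 LocIrr); **P6** III: `BIT_ω̃St = LocRed` (100/100). HONEST DEFECT reported by o5-r2, not repaired: BY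
THE LETTER of the frozen scope column (`surj3 = 1`) P4(III)/P6 are KILLED by the two CM rows 1089b1 / 1521a1 (`ρ̄₃` reducible
via the rational 3-isogeny; Cremona's galrep rows carry no code at `3`); the LAW SURVIVES on its stated hypothesis (`ρ̄`
surjective) — the records carry the three CM rows with `image = cm`, and the theorems below quantify over `image = surj`.
READING (o5-r2; planner-owned conjecture wording `O5.CongruenceBlockLocationLawAtNine`, NOT typed — only on request after
o5-r2's §G8-4 presearch): for `W` `3`-surjective, `9 ∥ N`, `X ≠` own block: `3 ∣ r(W;X)` ⟺ a weight-2 eigenform of `3`-type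
`X` (level `∣ 9M`) is `≡ W (mod 3)` ⟺ the local Serre-weight / Steinberg-shape / cuspidal-JH criterion on `E[3]|G_{ℚ₃}` (BDJ
weights at `p = 3`, Ribet–Mazur lowering, level raising AT `p`, Gee–Kisin potentially-BT lifts, CDT 1999 p. 553, Serre–Tate).
`e₃` (E-O5-CONG = depth, `O5.CongruenceDefectLawAtNine` p285845) is independent of all classifiers; BLOCKLOC = location.

TYPER PLACEMENT (cc-typer-5 GEN 10; idiom of p282961 / p283670 `CongruenceDefectAtNine{,Rows}.lean`): this file = the SCHEMA
(`BlockRow`, the classifier predicates, the per-kind prediction `BlockRow.Fits`, `FitsAll` + its `List` bookkeeping); the 800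
literal rows are split by the 400-line cap into `CongruenceBlockLocationAtNineRows{1,2,3}.lean`, each with its `decide +kernel`
theorems, and `…RowsAll.lean` assembles the census statements T-BL (all 720 `surj` rows fit; counts). Columns carried per
row: label, level, kind, image, the five bits, the `r`-vector (8), `e₃ = ord₃ r_E − ord₃ m_E`, `v₃(Δ_min)`, the classifier
residue `cls` (`Δ′ mod 9` for III/III*, `j mod 9` for I₀*-ord, `u mod 9` for Iₙ*, `0` for I₀*-ss) and `n` (Iₙ*; else `0`);
NOT carried: the modular degree `m_E` (not a column of the TSV of record; `e₃` is), the a-invariants (Cremona's table).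
COMPUTATIONAL EVIDENCE; nothing about any curve or modular form is asserted — the identification of a row with the named
optimal curve and of `r` with congruence numbers is DATA PROVENANCE (docstrings), not a Lean statement; 0 facts; no
`@[conjecture]` node. References: o5-r2 GEN 7/8 memos; [AgasheRibetStein2012] for `r_E`, `m_E`; [Cremona1997] for labels.
-/

set_option autoImplicit false

namespace Summit.BirchSwinnertonDyer.Rank1Residual.O5

/-- Local kind at `3` of a `9 ∥ N` optimal curve in the BLOCKLOC census: Kodaira III, III*, I₀* with the
`(−3)`-untwisted class ordinary / supersingular, Iₙ* (`n ≥ 1`, untwisted class multiplicative). [folklore] -/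
inductive BlockKind
  | III | IIIstar | I0starOrd | I0starSS | InStar
  deriving DecidableEq, Repr, Inhabited

/-- Mod-3 image class of the row: `surj` (Cremona `surj3 = 1`, `j` not CM), `borel` (`surj3 = 0`), `cm` (CM `j`). [folklore] -/
inductive BlockImage
  | surj | borel | cm
  deriving DecidableEq, Repr, Inhabited

/-- One BLOCKLOC census row (o5-r2 GEN 8 `blockloc_rows.tsv` 7a48964623c46596). Fields: Cremona label; level `N`
(`9 ∥ N ≤ 2000`); kind at `3`; image class; the five bits `BIT_X = [3 ∣ r(W;X)]` for `X = B0, B1, ω̃BT, ω̃St, SC`; the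
eight congruence numbers `r(W;X)`, `X ∈ [B0, B1, ω̃BT, ω̃St, SC, B0⊕B1, B0⊕B1⊕ω̃BT⊕ω̃St, ALL]`; `e₃ = ord₃ r_E − ord₃ m_E ∈ ℤ`
(`−1` once, on the `borel` row 990h1);
`v₃(Δ_min)`; the classifier residue `cls` (III/III*: `Δ′ mod 9`; I₀*-ord: `j mod 9`; Iₙ*: `(3ⁿj)⁻¹ mod 9`; I₀*-ss: `0`);
`n = −v₃(j)` for Iₙ* (else `0`). DATA. [folklore] -/
structure BlockRow where
  label : String
  level : ℕ
  kind : BlockKind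
  image : BlockImage
  b0 : Bool
  b1 : Bool
  bBT : Bool
  bSt : Bool
  bSC : Bool
  r : List ℕ
  e3 : ℤ
  vD : ℕ
  cls : ℕ
  n : ℕ
  deriving Repr

namespace BlockRow

/-- `±1 (mod 9)`. [folklore] -/
def isPmOneModNine (a : ℕ) : Bool := a % 9 == 1 || a % 9 == 8

/-- III / III*: `LocRed := [Δ′ ≢ ±1 (mod 9)]` (`= ¬ LocIrr(3)` on type III/III*, p304384). [folklore] -/
def locRed (ρ : BlockRow) : Bool := !isPmOneModNine ρ.cls

/-- I₀*-ord: `Split := [j ≡ ±1 (mod 9)]` (`E_G[3]|G_{ℚ₃}` split, Serre–Tate). [folklore] -/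
def split (ρ : BlockRow) : Bool := isPmOneModNine ρ.cls

/-- Iₙ*: `Peu := [3 ∣ n]`. [folklore] -/
def peu (ρ : BlockRow) : Bool := ρ.n % 3 == 0

/-- Iₙ*: `Cube := [3 ∣ n ∧ u ≡ ±1 (mod 9)]` (`q_G` a cube in `ℚ₃^×`). [folklore] -/
def cube (ρ : BlockRow) : Bool := ρ.n % 3 == 0 && isPmOneModNine ρ.cls

/-- The bits are the `3`-divisibility of the first five `r`-entries (instrument consistency, checked by `decide`). [folklore] -/
def bitsFromR (ρ : BlockRow) : Bool :=
  (ρ.r.length == 8) &&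
    (ρ.b0 == (ρ.r.getD 0 1 % 3 == 0)) && (ρ.b1 == (ρ.r.getD 1 1 % 3 == 0)) &&
    (ρ.bBT == (ρ.r.getD 2 1 % 3 == 0)) && (ρ.bSt == (ρ.r.getD 3 1 % 3 == 0)) && (ρ.bSC == (ρ.r.getD 4 1 % 3 == 0))

/-- **The pre-registered predictions P1, P1′, P2, P3, P4, P5, P6 of BLOCKLOC, by kind** (o5-r2 GEN 8 PREREG
eead2ab8cbfd2aac), as one Boolean per row; vacuous (`true`) off the `surj` image class. [folklore] -/
def fitsB (ρ : BlockRow) : Bool :=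
  match ρ.image with
  | .surj =>
    match ρ.kind with
    | .InStar => (ρ.bBT == ρ.peu) && (ρ.bSC == ρ.peu) && (ρ.b0 == ρ.cube) && (ρ.b1 == ρ.cube)
    | .I0starOrd => (ρ.b0 == ρ.split) && (ρ.b1 == ρ.split) && ρ.bSt && ρ.bSC
    | .I0starSS => !ρ.b0 && !ρ.b1 && !ρ.bSt && ρ.bSC
    | .IIIstar => ρ.b0 && !ρ.bBT && !ρ.bSt && (ρ.b1 == ρ.locRed)
    | .III => ρ.bBT && !ρ.b0 && !ρ.b1 && (ρ.bSt == ρ.locRed)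
  | _ => true

/-- Propositional form of `fitsB`. [folklore] -/
def Fits (ρ : BlockRow) : Prop := ρ.fitsB = true

/-- `Fits` is decidable (it is a Boolean equation). [folklore] -/
instance (ρ : BlockRow) : Decidable ρ.Fits := inferInstanceAs (Decidable (ρ.fitsB = true))

/-- Every row of the list fits the predictions and has consistent bits. [folklore] -/
def FitsAll (rs : List BlockRow) : Prop := (rs.all fun ρ ↦ ρ.fitsB && ρ.bitsFromR) = true

/-- `FitsAll` is decidable (a Boolean equation). [folklore] -/
instance (rs : List BlockRow) : Decidable (FitsAll rs) := inferInstanceAs (Decidable (_ = true))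

/-- From the list statement to each row. [folklore] -/
theorem fits_of_fitsAll {rs : List BlockRow} (h : FitsAll rs) : ∀ ρ ∈ rs, ρ.Fits ∧ ρ.bitsFromR = true := by
  intro ρ hρ
  have := List.all_eq_true.mp h ρ hρ
  simp only [Bool.and_eq_true] at this
  exact ⟨this.1, this.2⟩

/-- `FitsAll` is append-compatible (the 800 rows are split over three files). [folklore] -/
theorem fitsAll_append {rs rs' : List BlockRow} (h : FitsAll rs) (h' : FitsAll rs') : FitsAll (rs ++ rs') := by
  unfold FitsAll at *
  rw [List.all_append, h, h', Bool.and_self]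

/-- Row counters used by the census theorems. [folklore] -/
def countImage (rs : List BlockRow) (i : BlockImage) : ℕ := (rs.filter fun ρ ↦ decide (ρ.image = i)).length

/-- Count of `surj` rows of a given kind. [folklore] -/
def countSurjKind (rs : List BlockRow) (k : BlockKind) : ℕ :=
  (rs.filter fun ρ ↦ decide (ρ.image = .surj ∧ ρ.kind = k)).length

end BlockRow

end Summit.BirchSwinnertonDyer.Rank1Residual.O5
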